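import Literature.MathematicalPhysics.QuantumFieldTheory.Balaban1983to89.B9Ineq346SecondOrderFlatMultiLevelTorus

/-!
# `Balaban1983to89.B9Ineq346SecondOrderCaccioppoliTorus` — [B9] (3.46) AT `U = 1`, FILE 3b: THE MEMBER `‖h∇G′∇*λ‖`
FOR THE SCALAR PROPAGATOR `G′ = Δ′_a⁻¹` ON THE GENUINE `k`-LEVEL TORUS BY THE DISCRETE CACCIOPPOLI INEQUALITY —
for `supp λ ⊂ B(y′)`: `Σ_{x∈B(y)}((∂_μG′∂_νᵀλ)(x))² ≤ C·e^{−δd(y,y′)}·Σλ²` (cell GAP G-B9-03a: «(3.46) at U = 1 is not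
printed in [4]»; file 3b of the second-order programme of seat dag-n06-h g3; no existing module is touched; no fact is minted)

T. Bałaban, *Propagators for lattice gauge theories in a background field*, Commun. Math. Phys. **99** (1985) 389–434
[`Balaban1985BackgroundPropagators`, "B9"]; [4] = T. Bałaban, *Propagators and renormalization transformations for lattice
gauge theories. II*, Commun. Math. Phys. **96** (1984) 223–250 [`Balaban1984PropagatorsII`].

statement-level skeleton of published theorems with citation tags; proofs where landed; nothing here is a claim about the
Yang–Mills mass gap

THE PRINTED LOCI (verbatim).  (3.46), p. 398: *"… ‖h∇_UG′(U)∇\*_Uλ‖ … ≦ B₀[…, 1, …]|h|e^{−δ₀d(y,y′)}‖λ‖ for supp h ⊂ Δ̃(y),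
y ∈ Λ_j, supp λ ⊂ Δ(y′)"*; Cor. 3.5 p. 407: *"For … U = 1, these theorems are proved in [4]"* — [4] Prop. 2.2 (2.67) prints
the sup ∕ Hölder members only; this member has no sup majorant there.

THE ROUTE (kernel-checked; `U = 1`, lattice units of `B6MultiLevelTorusOperator`, blocks and `d = d_T` of
`B6Geom246MultiLevelTorus`).  With `u = G′∂_νᵀλ` (`Δ′_au = ∂_νᵀλ`, `Δ′_a = −Δ + V`) and the block-scale cut-off `χ = χ_y` of
`B9Ineq346SecondOrderTorusCutoff`, the discrete Caccioppoli inequality of `B9Ineq346SecondOrderTorusCore`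
(`Σχ(x+e)²(∂u)² ≤ 2⟨χ²u, −Δu⟩ + 8Σ(∂χ)²(u² + u′²)`) gives `Z := Σ_{μ′}‖χ(·+e_{μ′})∂_{μ′}u‖² ≤ 2|S| + W′` with the source
pairing `S = ⟨χ²u, ∂_νᵀλ⟩ = ⟨∂_ν(χ²u), λ⟩`, `S² ≤ (2Z + 32L^{−2j}‖1_𝒩u‖²)Σλ²` (Cauchy–Schwarz on `B(y′)`, `|∂χ| ≤ 2L^{−j}`), and
`W′ = 2Σ_{s∈𝒩}a_{j_s}L^{−2j_s}‖1_su‖² + 64(d+1)L^{−2j}‖1_𝒩u‖²` (averaging pairing `abs_form_V_le`, commutator); `S = 0` when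
`d(y′, y) > K₀ + 1`.  Absorbing (`quad_absorb`): `Z ≤ 2W′ + 32L^{−2j}‖1_𝒩u‖² + 9Σλ²·[y′ near y]`; the lower-order input
`‖1_su‖² ≤ CL^{j_s+j′}e^{−δd(s,y′)}Σλ²` is lit-balaban-p21's PROVED member `G′∇*` (`ineq346_Gpd_flat_multiLevelTorus`), the surplus
`L^{j′−j}` is paid by (2.60) (`transfer_rpow`), the count `#𝒩` by (2.61) (`consts_260_261`).

* §1 ★ `dGpd_local_estimate` (the four facts (i)–(iv) with explicit constants), ★★ `ineq346_dGpd_flat_multiLevelTorus`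
  (`k`-uniform `δ, C, M₀, N₀`; hypotheses VERBATIM those of p21's members).

HONEST SCOPE.  `U = 1` only; one-block cut-off ∕ support; squared form; lattice units (prefactor `1`); `∂` = the periodic
forward difference.  Nothing is inferred from the manuscript: every step is kernel-checked.  One finite lattice programme —
nothing continuum, nothing about the mass gap.  Cell `pub-ymgap` (HUMAN RULING D-0062), Track A node N06 [B9], N06-ASSIGNMENT
v1 row 11 (bundle F3) at def-Y's instance, seat `pub-ymgap-dag-n06-h` (g3), 2026-08-27.
-/

noncomputable section

namespace Literature.MathematicalPhysics.QuantumFieldTheory.Balaban1983to89.B9Ineq346SecondOrderCaccioppoliTorus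

open Finset Matrix
open B4Reflection242 (boxDom mem_boxDom)
open B6MultiLevelBoxOperator (N0 levC)
open B6MultiLevelTorusOperator
open B6Prop22DerivMultiLevelTorus (dT dT_mulVec)
open B6Geom246MultiLevelBox (bset blkOf scale_bounds)
open B6Geom246MultiLevelTorus (bondT geomT)
open B6Ineq243TwoLevelBox (aNext)
open B6Lemma21Repaired (Ineq261With)
open B9Thm314GpFlatMultiLevelTorus (consts_260_261)
open B9Ineq347GpFlatMultiLevelTorus (transfer_rpow)
open B9Ineq346GpFlatMultiLevelTorus (ineq346_Gpd_flat_multiLevelTorus)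
open B9Ineq346SecondOrderTorusCore
open B9Ineq346SecondOrderTorusCutoff
open B9Ineq346SecondOrderFlatMultiLevelTorus

variable {d : ℕ}

/-! ## §1 The member `∂_μG′∂_νᵀ`: the discrete Caccioppoli estimate -/

section MemberDGD

variable {ℓ Mh k R : ℕ} {P : Fin (d + 1) → ℕ} (D : TDomains d ℓ Mh k P R)

/-- absorbing the source pairing: `Z ≤ 2|S| + W`, `S² ≤ (2Z + B)Λ` (all `≥ 0`) give `Z ≤ 2W + 9Λ + B`. [folklore] -/
private theorem quad_absorb {Z S W B Λ : ℝ} (hZ0 : 0 ≤ Z) (hW : 0 ≤ W) (hB : 0 ≤ B) (hΛ : 0 ≤ Λ)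
    (hZ : Z ≤ 2 * |S| + W) (hS : S ^ 2 ≤ (2 * Z + B) * Λ) : Z ≤ 2 * W + 9 * Λ + B := by
  by_cases hZW : Z ≤ W
  · linarith
  rw [not_le] at hZW
  have h1 : (Z - W) ^ 2 ≤ 4 * S ^ 2 := by
    have h2 : Z - W ≤ 2 * |S| := by linarith
    have h3 : 0 ≤ Z - W := by linarith
    calc (Z - W) ^ 2 ≤ (2 * |S|) ^ 2 := pow_le_pow_left₀ h3 h2 2
      _ = 4 * S ^ 2 := by rw [mul_pow, sq_abs]; norm_num
  by_contra hlt
  rw [not_le] at hlt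
  nlinarith [mul_pos (by linarith : 0 < Z - (2 * W + 9 * Λ + B)) (by linarith : 0 < Z - (B + Λ)), sq_nonneg (B - Λ)]

/-- the forward difference of `χ²u`: `∂_ν(χ²u)(x) = χ(x+e)²(u(x+e) − u(x)) + (χ(x+e)² − χ(x)²)u(x)`, squared:
`≤ 2χ(x+e)²(u(x+e) − u(x))² + 2(χ(x+e)² − χ(x)²)²u(x)²` for `0 ≤ χ ≤ 1`. [cite: Balaban1985BackgroundPropagators, (3.46) p.398, dictionary] -/
private theorem sq_dT_chisq_u_le (p q a b : ℝ) (hp0 : 0 ≤ p) (hp1 : p ≤ 1) :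
    (p ^ 2 * b - q ^ 2 * a) ^ 2 ≤ 2 * (p ^ 2 * (b - a) ^ 2) + 2 * ((p ^ 2 - q ^ 2) ^ 2 * a ^ 2) := by
  have hp2 : p ^ 2 ≤ 1 := pow_le_one₀ hp0 hp1
  have e : p ^ 2 * b - q ^ 2 * a = p ^ 2 * (b - a) + (p ^ 2 - q ^ 2) * a := by ring
  rw [e]
  have h1 : (p ^ 2 * (b - a) + (p ^ 2 - q ^ 2) * a) ^ 2 ≤ 2 * (p ^ 2 * (b - a)) ^ 2 + 2 * ((p ^ 2 - q ^ 2) * a) ^ 2 := by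
    nlinarith [sq_nonneg (p ^ 2 * (b - a) - (p ^ 2 - q ^ 2) * a)]
  have h2 : (p ^ 2 * (b - a)) ^ 2 ≤ p ^ 2 * (b - a) ^ 2 := by
    rw [mul_pow, ← pow_mul]
    have : p ^ (2 * 2) ≤ p ^ 2 := by
      rw [pow_mul]; exact (pow_le_pow_left₀ (sq_nonneg p) hp2 2).trans_eq (one_pow 2) |>.trans (le_refl _) |> fun h =>
        by nlinarith [sq_nonneg p, h]
    exact mul_le_mul_of_nonneg_right this (sq_nonneg _)
  nlinarith [h1, h2, sq_nonneg ((p ^ 2 - q ^ 2) * a)]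

/-- ★ **THE LOCAL CACCIOPPOLI ESTIMATE FOR `∂_μu` ON A BLOCK**, `u` with `−Δu = ∂_νᵀλ − Vu` (e.g. `u = G′∂_νᵀλ`), all
constants explicit, no decay yet: with `χ = χ_y`, `Z = Σ_{μ′}Σ_x χ(x+e_{μ′})²(∂_{μ′}u(x))²`, `S = ⟨∂_ν(χ²u), λ⟩`,
`U² = ‖1_𝒩u‖²`, `W_V = Σ_{s∈𝒩}a′_{j_s}L^{−2j_s}‖1_su‖²`: (i) `‖1_{B(y)}∂_μu‖² ≤ Z`; (ii) `Z ≤ 2|S| + 2W_V + 64(d+1)L^{−2j}U²`;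
(iii) `S² ≤ (2Z + 32L^{−2j}U²)·Σλ²`; (iv) `S = 0` if `d(y′, y) > K₀ + 1`.
[cite: Balaban1985BackgroundPropagators, (3.46) p.398 (the member ∇G′∇* at U = 1); Balaban1984PropagatorsII, (2.13)–(2.14) p.225] -/
theorem dGpd_local_estimate (hℓ : 1 ≤ ℓ) (hMh : 3 ≤ Mh) (hR : 2 * (ℓ + 1) ≤ R) (hP4 : ∀ μ, 4 ≤ P μ)
    {a' : ℕ → ℝ} (ha'0 : ∀ j, 0 ≤ a' j) (μ ν : Fin (d + 1)) (y y' : ↥(bset D.toDomains))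
    (u lam : ↥(boxDom (N0 ℓ Mh k P)) → ℝ) (hlam : ∀ z, blkOf D.toDomains z ≠ y' → lam z = 0)
    (hLu : ∀ x, (perLapT (N0 ℓ Mh k P) *ᵥ u) x = ((dT (N0 ℓ Mh k P) ν)ᵀ *ᵥ lam) x - levC d ℓ a' (D.lev x.1)
      * ∑ z ∈ Finset.univ.filter (fun z => blkOf D.toDomains z = blkOf D.toDomains x), u z) :
    (∑ x ∈ Finset.univ.filter (fun x => blkOf D.toDomains x = y), ((dT (N0 ℓ Mh k P) μ *ᵥ u) x) ^ 2 ≤ ∑ μ' : Fin (d + 1), ∑ x, cutoffT D y (tshift (N0 ℓ Mh k P) (unitVec μ') x) ^ 2 * (u (tshift (N0 ℓ Mh k P) (unitVec μ') x) - u x) ^ 2) ∧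
    (∑ μ' : Fin (d + 1), ∑ x, cutoffT D y (tshift (N0 ℓ Mh k P) (unitVec μ') x) ^ 2 * (u (tshift (N0 ℓ Mh k P) (unitVec μ') x) - u x) ^ 2 ≤ 2 * |(dT (N0 ℓ Mh k P) ν *ᵥ (fun x => cutoffT D y x ^ 2 * u x)) ⬝ᵥ lam| + (2 * (∑ s ∈ Finset.univ.filter (fun s => (bondT D).dist s y ≤ (d + 1) * (4 * (ℓ + 1) + 1) + 1), a' s.1.1 * ((((ℓ : ℝ) + 1) ^ s.1.1) ^ 2)⁻¹ * ∑ x ∈ Finset.univ.filter (fun x => blkOf D.toDomains x = s), u x ^ 2) + 64 * ((d : ℝ) + 1) / ((side D y : ℝ) ^ 2) * (∑ s ∈ Finset.univ.filter (fun s => (bondT D).dist s y ≤ (d + 1) * (4 * (ℓ + 1) + 1) + 1), ∑ x ∈ Finset.univ.filter (fun x => blkOf D.toDomains x = s), u x ^ 2))) ∧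
    (((dT (N0 ℓ Mh k P) ν *ᵥ (fun x => cutoffT D y x ^ 2 * u x)) ⬝ᵥ lam) ^ 2 ≤ (2 * (∑ μ' : Fin (d + 1), ∑ x, cutoffT D y (tshift (N0 ℓ Mh k P) (unitVec μ') x) ^ 2 * (u (tshift (N0 ℓ Mh k P) (unitVec μ') x) - u x) ^ 2) + 32 / ((side D y : ℝ) ^ 2) * (∑ s ∈ Finset.univ.filter (fun s => (bondT D).dist s y ≤ (d + 1) * (4 * (ℓ + 1) + 1) + 1), ∑ x ∈ Finset.univ.filter (fun x => blkOf D.toDomains x = s), u x ^ 2)) * ∑ z, lam z ^ 2) ∧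
    ((d + 1) * (4 * (ℓ + 1) + 1) + 1 < (bondT D).dist y' y → (dT (N0 ℓ Mh k P) ν *ᵥ (fun x => cutoffT D y x ^ 2 * u x)) ⬝ᵥ lam = 0) := by
  classical
  have hMh1 : 1 ≤ Mh := le_trans (by norm_num) hMh
  have hP : ∀ μ, 1 ≤ P μ := fun μ => le_trans (by norm_num) (hP4 μ)
  set χ : ↥(boxDom (N0 ℓ Mh k P)) → ℝ := cutoffT D y with hχ
  set 𝒩 := Finset.univ.filter (fun s => (bondT D).dist s y ≤ (d + 1) * (4 * (ℓ + 1) + 1) + 1) with h𝒩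
  have hχ0 : ∀ x, 0 ≤ χ x := cutoffT_nonneg D y
  have hχ1 : ∀ x, χ x ≤ 1 := cutoffT_le_one D y
  have hn : (0 : ℝ) < (side D y : ℝ) := by exact_mod_cast one_le_side D y
  -- support bookkeeping
  have hnear : ∀ (x : ↥(boxDom (N0 ℓ Mh k P))) (μ' : Fin (d + 1)) (ε : ℤ), |ε| ≤ 1 →
      χ (tshift (N0 ℓ Mh k P) (ε • unitVec μ') x) ≠ 0 → blkOf D.toDomains x ∈ 𝒩 := by
    intro x μ' ε hε hx
    rw [h𝒩, Finset.mem_filter]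
    exact ⟨Finset.mem_univ _, distT_le_of_cutoffT_tshift_ne_zero D hℓ hMh hR hP4 y x μ' ε hε hx⟩
  have hnear0 : ∀ x : ↥(boxDom (N0 ℓ Mh k P)), χ x ≠ 0 → blkOf D.toDomains x ∈ 𝒩 := by
    intro x hx
    refine hnear x μ 0 (by simp) ?_
    rwa [zero_smul, tshift_zero]
  have hnear1 : ∀ (x : ↥(boxDom (N0 ℓ Mh k P))) (μ' : Fin (d + 1)), χ (tshift (N0 ℓ Mh k P) (unitVec μ') x) ≠ 0 → blkOf D.toDomains x ∈ 𝒩 :=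
    fun x μ' hx => hnear x μ' 1 (by simp) (by rwa [one_smul])
  have hlip : ∀ (x : ↥(boxDom (N0 ℓ Mh k P))) (μ' : Fin (d + 1)), |χ (tshift (N0 ℓ Mh k P) (unitVec μ') x) - χ x| ≤ 2 / (side D y : ℝ) :=
    fun x μ' => cutoffT_lipschitz D y hMh1 hP μ' x
  have hZ0 : 0 ≤ ∑ μ' : Fin (d + 1), ∑ x, cutoffT D y (tshift (N0 ℓ Mh k P) (unitVec μ') x) ^ 2 * (u (tshift (N0 ℓ Mh k P) (unitVec μ') x) - u x) ^ 2 := Finset.sum_nonneg fun _ _ => Finset.sum_nonneg fun _ _ => by positivity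
  refine ⟨?_, ?_, ?_, ?_⟩
  · -- (i) the plateau `χ(x + e_μ) = 1` on `B(y)`
    calc ∑ x ∈ Finset.univ.filter (fun x => blkOf D.toDomains x = y), ((dT (N0 ℓ Mh k P) μ *ᵥ u) x) ^ 2
        = ∑ x ∈ Finset.univ.filter (fun x => blkOf D.toDomains x = y), χ (tshift (N0 ℓ Mh k P) (unitVec μ) x) ^ 2 * (u (tshift (N0 ℓ Mh k P) (unitVec μ) x) - u x) ^ 2 := by
          refine Finset.sum_congr rfl fun x hx => ?_
          have hxy : blkOf D.toDomains x = y := (Finset.mem_filter.1 hx).2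
          have h1 : χ (tshift (N0 ℓ Mh k P) (unitVec μ) x) = 1 := (cutoffT_plateau_shifts D y hMh1 hP hxy μ μ).2.1
          rw [dT_mulVec, h1]; ring
      _ ≤ ∑ x, χ (tshift (N0 ℓ Mh k P) (unitVec μ) x) ^ 2 * (u (tshift (N0 ℓ Mh k P) (unitVec μ) x) - u x) ^ 2 :=
          Finset.sum_le_sum_of_subset_of_nonneg (Finset.filter_subset _ _) fun _ _ _ => by positivity
      _ ≤ ∑ μ' : Fin (d + 1), ∑ x, cutoffT D y (tshift (N0 ℓ Mh k P) (unitVec μ') x) ^ 2 * (u (tshift (N0 ℓ Mh k P) (unitVec μ') x) - u x) ^ 2 :=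
          Finset.single_le_sum (f := fun μ' => ∑ x, χ (tshift (N0 ℓ Mh k P) (unitVec μ') x) ^ 2
            * (u (tshift (N0 ℓ Mh k P) (unitVec μ') x) - u x) ^ 2)
            (fun μ' _ => Finset.sum_nonneg fun _ _ => by positivity) (Finset.mem_univ μ)
  · -- (ii) Caccioppoli, the equation, the averaging pairing and the commutator
    have hcacc := caccioppoli_torus (N0 ℓ Mh k P) χ u
    -- the form `⟨χ²u, −Δu⟩ = S − (V-pairing)`
    have hform : (fun z => χ z ^ 2 * u z) ⬝ᵥ perLapT (N0 ℓ Mh k P) *ᵥ u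
        = (dT (N0 ℓ Mh k P) ν *ᵥ (fun x => cutoffT D y x ^ 2 * u x)) ⬝ᵥ lam - ∑ x, χ x ^ 2 * u x * (levC d ℓ a' (D.lev x.1)
            * ∑ z ∈ Finset.univ.filter (fun z => blkOf D.toDomains z = blkOf D.toDomains x), u z) := by
      have e1 : (fun z => χ z ^ 2 * u z) ⬝ᵥ perLapT (N0 ℓ Mh k P) *ᵥ u
          = ∑ x, χ x ^ 2 * u x * (((dT (N0 ℓ Mh k P) ν)ᵀ *ᵥ lam) x - levC d ℓ a' (D.lev x.1)
            * ∑ z ∈ Finset.univ.filter (fun z => blkOf D.toDomains z = blkOf D.toDomains x), u z) := by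
        unfold dotProduct; exact Finset.sum_congr rfl fun x _ => by rw [hLu x]
      have e2 : (dT (N0 ℓ Mh k P) ν *ᵥ (fun x => cutoffT D y x ^ 2 * u x)) ⬝ᵥ lam = ∑ x, χ x ^ 2 * u x * ((dT (N0 ℓ Mh k P) ν)ᵀ *ᵥ lam) x := by
        rw [← Matrix.vecMul_transpose, ← Matrix.dotProduct_mulVec]; rfl
      rw [e1, e2, ← Finset.sum_sub_distrib]
      exact Finset.sum_congr rfl fun x _ => by ring
    have hV := abs_form_V_le D a' ha'0 χ u 𝒩 hχ0 hχ1 hnear0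
    -- the commutator weights `(χ(x+e) − χ(x))² ≤ 4/L^{2j}`, localised over `𝒩` (the second copy after a translation)
    have hE : ∑ μ' : Fin (d + 1), ∑ x, (χ (tshift (N0 ℓ Mh k P) (unitVec μ') x) - χ x) ^ 2
          * (u x ^ 2 + u (tshift (N0 ℓ Mh k P) (unitVec μ') x) ^ 2)
        ≤ 2 * ((d : ℝ) + 1) * (2 / (side D y : ℝ)) ^ 2 * (∑ s ∈ Finset.univ.filter (fun s => (bondT D).dist s y ≤ (d + 1) * (4 * (ℓ + 1) + 1) + 1), ∑ x ∈ Finset.univ.filter (fun x => blkOf D.toDomains x = s), u x ^ 2) := by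
      have key : ∀ μ' : Fin (d + 1), ∑ x, (χ (tshift (N0 ℓ Mh k P) (unitVec μ') x) - χ x) ^ 2
          * (u x ^ 2 + u (tshift (N0 ℓ Mh k P) (unitVec μ') x) ^ 2) ≤ 2 * ((2 / (side D y : ℝ)) ^ 2 * (∑ s ∈ Finset.univ.filter (fun s => (bondT D).dist s y ≤ (d + 1) * (4 * (ℓ + 1) + 1) + 1), ∑ x ∈ Finset.univ.filter (fun x => blkOf D.toDomains x = s), u x ^ 2)) := by
        intro μ'
        have hA := sum_weight_le D (fun x => (χ (tshift (N0 ℓ Mh k P) (unitVec μ') x) - χ x) ^ 2) (fun x => u x ^ 2) 𝒩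
          (Wc := (2 / (side D y : ℝ)) ^ 2)
          (fun x => by rw [← sq_abs]; exact pow_le_pow_left₀ (abs_nonneg _) (hlip x μ') 2)
          (fun x => sq_nonneg _)
          (fun x hx => by
            by_cases h0 : χ x = 0
            · have h1 : χ (tshift (N0 ℓ Mh k P) (unitVec μ') x) ≠ 0 := by intro h1; apply hx; rw [h0, h1]; ring
              exact hnear1 x μ' h1
            · exact hnear0 x h0)
        -- the translated copy: reindex `x ↦ x − e_μ′`
        have hB' : ∑ x, (χ (tshift (N0 ℓ Mh k P) (unitVec μ') x) - χ x) ^ 2 * u (tshift (N0 ℓ Mh k P) (unitVec μ') x) ^ 2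
            = ∑ x, (χ x - χ (tshift (N0 ℓ Mh k P) (-unitVec μ') x)) ^ 2 * u x ^ 2 := by
          rw [← Equiv.sum_comp (tshift (N0 ℓ Mh k P) (-unitVec μ'))
            (fun x => (χ (tshift (N0 ℓ Mh k P) (unitVec μ') x) - χ x) ^ 2 * u (tshift (N0 ℓ Mh k P) (unitVec μ') x) ^ 2)]
          refine Finset.sum_congr rfl fun x _ => ?_
          simp only [tshift_tshift, neg_add_cancel, tshift_zero]
        have hB := sum_weight_le D (fun x => (χ x - χ (tshift (N0 ℓ Mh k P) (-unitVec μ') x)) ^ 2) (fun x => u x ^ 2) 𝒩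
          (Wc := (2 / (side D y : ℝ)) ^ 2)
          (fun x => by
            have h := hlip (tshift (N0 ℓ Mh k P) (-unitVec μ') x) μ'
            rw [tshift_tshift, neg_add_cancel, tshift_zero] at h
            rw [← sq_abs]; exact pow_le_pow_left₀ (abs_nonneg _) h 2)
          (fun x => sq_nonneg _)
          (fun x hx => by
            by_cases h0 : χ x = 0
            · have h1 : χ (tshift (N0 ℓ Mh k P) (-unitVec μ') x) ≠ 0 := by intro h1; apply hx; rw [h0, h1]; ring
              exact hnear x μ' (-1) (by simp) (by rwa [neg_one_smul])
            · exact hnear0 x h0)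
        have hsplit : ∑ x, (χ (tshift (N0 ℓ Mh k P) (unitVec μ') x) - χ x) ^ 2 * (u x ^ 2 + u (tshift (N0 ℓ Mh k P) (unitVec μ') x) ^ 2)
            = (∑ x, (χ (tshift (N0 ℓ Mh k P) (unitVec μ') x) - χ x) ^ 2 * u x ^ 2)
              + ∑ x, (χ (tshift (N0 ℓ Mh k P) (unitVec μ') x) - χ x) ^ 2 * u (tshift (N0 ℓ Mh k P) (unitVec μ') x) ^ 2 := by
          rw [← Finset.sum_add_distrib]; exact Finset.sum_congr rfl fun x _ => by ring
        rw [hsplit, hB']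
        linarith
      calc _ ≤ ∑ _μ' : Fin (d + 1), 2 * ((2 / (side D y : ℝ)) ^ 2 * (∑ s ∈ Finset.univ.filter (fun s => (bondT D).dist s y ≤ (d + 1) * (4 * (ℓ + 1) + 1) + 1), ∑ x ∈ Finset.univ.filter (fun x => blkOf D.toDomains x = s), u x ^ 2)) := Finset.sum_le_sum fun μ' _ => key μ'
        _ = _ := by rw [Finset.sum_const, Finset.card_univ, Fintype.card_fin, nsmul_eq_mul]; push_cast; ring
    rw [hform] at hcacc
    have hab : 2 * ((dT (N0 ℓ Mh k P) ν *ᵥ (fun x => cutoffT D y x ^ 2 * u x)) ⬝ᵥ lam - ∑ x, χ x ^ 2 * u x * (levC d ℓ a' (D.lev x.1)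
            * ∑ z ∈ Finset.univ.filter (fun z => blkOf D.toDomains z = blkOf D.toDomains x), u z))
        ≤ 2 * |(dT (N0 ℓ Mh k P) ν *ᵥ (fun x => cutoffT D y x ^ 2 * u x)) ⬝ᵥ lam| + 2 * (∑ s ∈ Finset.univ.filter (fun s => (bondT D).dist s y ≤ (d + 1) * (4 * (ℓ + 1) + 1) + 1), a' s.1.1 * ((((ℓ : ℝ) + 1) ^ s.1.1) ^ 2)⁻¹ * ∑ x ∈ Finset.univ.filter (fun x => blkOf D.toDomains x = s), u x ^ 2) := by
      have h1 := le_abs_self ((dT (N0 ℓ Mh k P) ν *ᵥ (fun x => cutoffT D y x ^ 2 * u x)) ⬝ᵥ lam)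
      have h2 := neg_abs_le (∑ x, χ x ^ 2 * u x * (levC d ℓ a' (D.lev x.1)
            * ∑ z ∈ Finset.univ.filter (fun z => blkOf D.toDomains z = blkOf D.toDomains x), u z))
      linarith [hV]
    have hfin : 8 * (2 * ((d : ℝ) + 1) * (2 / (side D y : ℝ)) ^ 2 * (∑ s ∈ Finset.univ.filter (fun s => (bondT D).dist s y ≤ (d + 1) * (4 * (ℓ + 1) + 1) + 1), ∑ x ∈ Finset.univ.filter (fun x => blkOf D.toDomains x = s), u x ^ 2))
        = 64 * ((d : ℝ) + 1) / ((side D y : ℝ) ^ 2) * (∑ s ∈ Finset.univ.filter (fun s => (bondT D).dist s y ≤ (d + 1) * (4 * (ℓ + 1) + 1) + 1), ∑ x ∈ Finset.univ.filter (fun x => blkOf D.toDomains x = s), u x ^ 2) := by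
      field_simp; ring
    linarith [hcacc, hab, hE, hfin]
  · -- (iii) Cauchy–Schwarz for the source pairing on `B(y′)`
    have hU2nn : 0 ≤ ∑ s ∈ Finset.univ.filter (fun s => (bondT D).dist s y ≤ (d + 1) * (4 * (ℓ + 1) + 1) + 1), ∑ x ∈ Finset.univ.filter (fun x => blkOf D.toDomains x = s), u x ^ 2 := Finset.sum_nonneg fun _ _ => Finset.sum_nonneg fun _ _ => sq_nonneg _
    have hSeq : (dT (N0 ℓ Mh k P) ν *ᵥ (fun x => cutoffT D y x ^ 2 * u x)) ⬝ᵥ lam = ∑ x ∈ Finset.univ.filter (fun x => blkOf D.toDomains x = y'), (dT (N0 ℓ Mh k P) ν *ᵥ (fun x => χ x ^ 2 * u x)) x * lam x := by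
      unfold dotProduct
      rw [← Finset.sum_subset (Finset.subset_univ _) (fun z _ hz => by
        rw [hlam z (fun h => hz (Finset.mem_filter.2 ⟨Finset.mem_univ _, h⟩)), mul_zero])]
    have hCS := Finset.sum_mul_sq_le_sq_mul_sq (Finset.univ.filter (fun x => blkOf D.toDomains x = y'))
      (fun x => (dT (N0 ℓ Mh k P) ν *ᵥ (fun x => χ x ^ 2 * u x)) x) lam
    have hΛ : ∑ x ∈ Finset.univ.filter (fun x => blkOf D.toDomains x = y'), lam x ^ 2 = ∑ z, lam z ^ 2 :=
      Finset.sum_subset (Finset.subset_univ _) (fun z _ hz => by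
        rw [hlam z (fun h => hz (Finset.mem_filter.2 ⟨Finset.mem_univ _, h⟩))]; ring)
    -- pointwise: `(∂_ν(χ²u))(x)² ≤ 2χ(x+e)²(∂u)² + 2(χ(x+e)² − χ(x)²)²u(x)²`
    have hpt : ∀ x, ((dT (N0 ℓ Mh k P) ν *ᵥ (fun x => χ x ^ 2 * u x)) x) ^ 2
        ≤ 2 * (χ (tshift (N0 ℓ Mh k P) (unitVec ν) x) ^ 2 * (u (tshift (N0 ℓ Mh k P) (unitVec ν) x) - u x) ^ 2)
          + 2 * ((χ (tshift (N0 ℓ Mh k P) (unitVec ν) x) ^ 2 - χ x ^ 2) ^ 2 * u x ^ 2) := by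
      intro x
      rw [dT_mulVec]
      exact sq_dT_chisq_u_le _ _ _ _ (hχ0 _) (hχ1 _)
    have hsumB : ∑ x ∈ Finset.univ.filter (fun x => blkOf D.toDomains x = y'), ((dT (N0 ℓ Mh k P) ν *ᵥ (fun x => χ x ^ 2 * u x)) x) ^ 2
        ≤ 2 * (∑ μ' : Fin (d + 1), ∑ x, cutoffT D y (tshift (N0 ℓ Mh k P) (unitVec μ') x) ^ 2 * (u (tshift (N0 ℓ Mh k P) (unitVec μ') x) - u x) ^ 2) + 32 / ((side D y : ℝ) ^ 2) * (∑ s ∈ Finset.univ.filter (fun s => (bondT D).dist s y ≤ (d + 1) * (4 * (ℓ + 1) + 1) + 1), ∑ x ∈ Finset.univ.filter (fun x => blkOf D.toDomains x = s), u x ^ 2) := by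
      have h1 : ∑ x ∈ Finset.univ.filter (fun x => blkOf D.toDomains x = y'), χ (tshift (N0 ℓ Mh k P) (unitVec ν) x) ^ 2 * (u (tshift (N0 ℓ Mh k P) (unitVec ν) x) - u x) ^ 2
          ≤ ∑ μ' : Fin (d + 1), ∑ x, cutoffT D y (tshift (N0 ℓ Mh k P) (unitVec μ') x) ^ 2 * (u (tshift (N0 ℓ Mh k P) (unitVec μ') x) - u x) ^ 2 :=
        (Finset.sum_le_sum_of_subset_of_nonneg (Finset.filter_subset _ _) fun _ _ _ => by positivity).trans
          (Finset.single_le_sum (f := fun μ' => ∑ x, χ (tshift (N0 ℓ Mh k P) (unitVec μ') x) ^ 2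
            * (u (tshift (N0 ℓ Mh k P) (unitVec μ') x) - u x) ^ 2)
            (fun μ' _ => Finset.sum_nonneg fun _ _ => by positivity) (Finset.mem_univ ν))
      -- the weight `(χ(x+e)² − χ(x)²)² ≤ (4/L^j)²`, nonzero only over `𝒩`
      have h2 : ∑ x ∈ Finset.univ.filter (fun x => blkOf D.toDomains x = y'), (χ (tshift (N0 ℓ Mh k P) (unitVec ν) x) ^ 2 - χ x ^ 2) ^ 2 * u x ^ 2
          ≤ (4 / (side D y : ℝ)) ^ 2 * (∑ s ∈ Finset.univ.filter (fun s => (bondT D).dist s y ≤ (d + 1) * (4 * (ℓ + 1) + 1) + 1), ∑ x ∈ Finset.univ.filter (fun x => blkOf D.toDomains x = s), u x ^ 2) := by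
        refine (Finset.sum_le_sum_of_subset_of_nonneg (Finset.filter_subset _ _) fun _ _ _ => by positivity).trans ?_
        refine sum_weight_le D (fun x => (χ (tshift (N0 ℓ Mh k P) (unitVec ν) x) ^ 2 - χ x ^ 2) ^ 2) (fun x => u x ^ 2) 𝒩
          (Wc := (4 / (side D y : ℝ)) ^ 2) (fun x => ?_) (fun x => sq_nonneg _) (fun x hx => ?_)
        · have hl := hlip x ν
          have e : χ (tshift (N0 ℓ Mh k P) (unitVec ν) x) ^ 2 - χ x ^ 2
              = (χ (tshift (N0 ℓ Mh k P) (unitVec ν) x) - χ x) * (χ (tshift (N0 ℓ Mh k P) (unitVec ν) x) + χ x) := by ring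
          rw [e, mul_pow, show (4 / (side D y : ℝ)) ^ 2 = (2 / (side D y : ℝ)) ^ 2 * 2 ^ 2 by ring]
          refine mul_le_mul ?_ ?_ (sq_nonneg _) (sq_nonneg _)
          · rw [← sq_abs]; exact pow_le_pow_left₀ (abs_nonneg _) hl 2
          · rw [← sq_abs]
            refine pow_le_pow_left₀ (abs_nonneg _) ?_ 2
            rw [abs_le]; constructor <;> linarith [hχ0 x, hχ1 x, hχ0 (tshift (N0 ℓ Mh k P) (unitVec ν) x), hχ1 (tshift (N0 ℓ Mh k P) (unitVec ν) x)]
        · by_cases h0 : χ x = 0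
          · have h1 : χ (tshift (N0 ℓ Mh k P) (unitVec ν) x) ≠ 0 := by intro h1; apply hx; rw [h0, h1]; ring
            exact hnear1 x ν h1
          · exact hnear0 x h0
      calc _ ≤ ∑ x ∈ Finset.univ.filter (fun x => blkOf D.toDomains x = y'), (2 * (χ (tshift (N0 ℓ Mh k P) (unitVec ν) x) ^ 2
              * (u (tshift (N0 ℓ Mh k P) (unitVec ν) x) - u x) ^ 2)
            + 2 * ((χ (tshift (N0 ℓ Mh k P) (unitVec ν) x) ^ 2 - χ x ^ 2) ^ 2 * u x ^ 2)) := Finset.sum_le_sum fun x _ => hpt x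
        _ = 2 * ∑ x ∈ Finset.univ.filter (fun x => blkOf D.toDomains x = y'), χ (tshift (N0 ℓ Mh k P) (unitVec ν) x) ^ 2 * (u (tshift (N0 ℓ Mh k P) (unitVec ν) x) - u x) ^ 2
            + 2 * ∑ x ∈ Finset.univ.filter (fun x => blkOf D.toDomains x = y'), (χ (tshift (N0 ℓ Mh k P) (unitVec ν) x) ^ 2 - χ x ^ 2) ^ 2 * u x ^ 2 := by
            rw [Finset.sum_add_distrib, Finset.mul_sum, Finset.mul_sum]
        _ ≤ 2 * (∑ μ' : Fin (d + 1), ∑ x, cutoffT D y (tshift (N0 ℓ Mh k P) (unitVec μ') x) ^ 2 * (u (tshift (N0 ℓ Mh k P) (unitVec μ') x) - u x) ^ 2) + 2 * ((4 / (side D y : ℝ)) ^ 2 * (∑ s ∈ Finset.univ.filter (fun s => (bondT D).dist s y ≤ (d + 1) * (4 * (ℓ + 1) + 1) + 1), ∑ x ∈ Finset.univ.filter (fun x => blkOf D.toDomains x = s), u x ^ 2)) := by linarith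
        _ = _ := by field_simp; ring
    rw [hSeq]
    refine hCS.trans ?_
    rw [hΛ]
    exact mul_le_mul_of_nonneg_right hsumB (Finset.sum_nonneg fun _ _ => sq_nonneg _)
  · -- (iv) far blocks: the pairing vanishes
    intro hfar
    unfold dotProduct
    refine Finset.sum_eq_zero fun x _ => ?_
    by_cases hl : lam x = 0
    · rw [hl, mul_zero]
    · have hxy' : blkOf D.toDomains x = y' := by by_contra h; exact hl (hlam x h)
      have hK : ¬ blkOf D.toDomains x ∈ 𝒩 := by
        rw [h𝒩, Finset.mem_filter, hxy']; push Not; intro; omega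
      have h0 : χ x = 0 := by by_contra h; exact hK (hnear0 x h)
      have h1 : χ (tshift (N0 ℓ Mh k P) (unitVec ν) x) = 0 := by by_contra h; exact hK (hnear1 x ν h)
      rw [dT_mulVec]
      simp only [h0, h1]
      ring

set_option maxHeartbeats 400000 in -- one long assembly of explicit constants; bookkeeping length, not search
/-- ★★ **(3.46), THE MEMBER `‖h∇G′∇*λ‖` AT `U = 1` ON THE GENUINE `k`-LEVEL TORUS** (one-block cut-off ∕ support, squared,
lattice units, prefactor `1`): there are `δ, C, M₀ > 0`, `N₀` (functions of `d, ℓ` and the weight windows) such that for all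
`k`, `M_h ≥ 3` with `L·M_h ≥ M₀`, `R ≥ 2L` with `R·L·M_h ≥ N₀ + 1`, torus sizes `P_μ ≥ 4`, families `D`, weights in the windows,
directions `μ, ν`, blocks `y, y′` and `λ = 0` off `B(y′)`:
`Σ_{x∈B(y)}((∂_μG′∂_νᵀλ)(x))² ≤ C·e^{−δd(y,y′)}·Σλ²` — discrete Caccioppoli at the block scale.
[cite: Balaban1985BackgroundPropagators, Thm 3.1 (3.46) p.398 + Cor. 3.5 p.407; Balaban1984PropagatorsII, Prop. 2.2 (2.67), Lemma 2.1 (2.60)–(2.61) p.234] -/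
theorem ineq346_dGpd_flat_multiLevelTorus (d ℓ : ℕ) (hℓ : 1 ≤ ℓ) (aminus aplus a2minus a2plus : ℝ) (ha : 0 < aminus)
    (ha2 : 0 < a2minus) :
    ∃ δ C M₀ : ℝ, ∃ N₀ : ℕ, 0 < δ ∧ 0 < C ∧ 0 < M₀ ∧ 0 < N₀ ∧
      ∀ (k Mh R : ℕ), 3 ≤ Mh → M₀ ≤ ((ℓ : ℝ) + 1) * Mh → 2 * (ℓ + 1) ≤ R → N₀ + 1 ≤ R * ((ℓ + 1) * Mh) →
      ∀ (P : Fin (d + 1) → ℕ) (hP : ∀ μ, 1 ≤ P μ) (hP4 : ∀ μ, 4 ≤ P μ) (D : TDomains d ℓ Mh k P R) (a c : ℕ → ℝ),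
        (∀ i, 1 ≤ i → aminus ≤ a i ∧ a i ≤ aplus) → (∀ i, 1 ≤ i → a2minus ≤ c i ∧ c i ≤ a2plus) →
        (∀ i, 1 ≤ i → a (i + 1) = aNext ℓ (a i) (c i)) →
      ∀ (μ ν : Fin (d + 1)) (y y' : ↥(bset D.toDomains)) (lam : ↥(boxDom (N0 ℓ Mh k P)) → ℝ),
        (∀ z, blkOf D.toDomains z ≠ y' → lam z = 0) →
        ∑ x ∈ Finset.univ.filter (fun x => blkOf D.toDomains x = y),
            (((dT (N0 ℓ Mh k P) μ * gmlT (N0 ℓ Mh k P) ℓ k D.lev a * (dT (N0 ℓ Mh k P) ν)ᵀ) *ᵥ lam) x) ^ 2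
          ≤ C * Real.exp (-(δ * (geomT D).dist y y')) * ∑ z, lam z ^ 2 := by
  classical
  have hL0 : (0 : ℝ) < (ℓ : ℝ) + 1 := by positivity
  have hL1 : (1 : ℝ) ≤ (ℓ : ℝ) + 1 := by linarith [(Nat.cast_nonneg ℓ : (0 : ℝ) ≤ ℓ)]
  -- p21's member 2, Lemma 2.1 at its rate
  obtain ⟨δ, Cc, Mc, Nc, hδ, hCc, hMc, -, Hc⟩ := ineq346_Gpd_flat_multiLevelTorus d ℓ hℓ aminus aplus a2minus a2plus ha ha2
  obtain ⟨Nq, cq, -, hcq, hconq⟩ := consts_260_261 d ℓ hδ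
  set K₀ : ℕ := (d + 1) * (4 * (ℓ + 1) + 1) with hK₀
  set K : ℕ := K₀ + 1 with hKdef
  set CN : ℝ := cq * Real.exp (1 / 4 * δ * K) with hCN
  have hCN0 : 0 ≤ CN := by positivity
  set C : ℝ := Real.exp (δ * K) * (9 + CN * Cc * ((ℓ : ℝ) + 1) ^ 2 * (4 * max aplus 0 + 128 * ((d : ℝ) + 1) + 32))
    with hCdef
  have hC : 0 < C := by positivity
  refine ⟨δ / 4, C, Mc, max Nc (max Nq (K₀ + 3)), by positivity, hC, hMc, lt_max_of_lt_right (lt_max_of_lt_right (by omega)), ?_⟩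
  intro k Mh R hMh hM hR hRN P hP hP4 D a c haw hcw hrec μ ν y y' lam hlam
  have hMh1 : 1 ≤ Mh := le_trans (by norm_num) hMh
  have hRNc : Nc + 1 ≤ R * ((ℓ + 1) * Mh) := le_trans (by simp only [add_le_add_iff_right]; exact le_max_left _ _) hRN
  have hRNq : Nq + 1 ≤ R * ((ℓ + 1) * Mh) := le_trans (by simp only [add_le_add_iff_right]; exact (le_max_left _ _).trans (le_max_right _ _)) hRN
  have hRK : K + 1 ≤ R * ((ℓ + 1) * Mh) - 1 := by
    have : K₀ + 3 + 1 ≤ R * ((ℓ + 1) * Mh) := le_trans (by simp only [add_le_add_iff_right]; exact (le_max_right _ _).trans (le_max_right _ _)) hRN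
    omega
  have hRM1 : 1 ≤ R * ((ℓ + 1) * Mh) := le_trans (by omega) hRNq
  obtain ⟨hthr, h261⟩ := hconq k Mh R P hMh1 hP hRNq
  have h261D := h261 D
  -- the repaired weights
  obtain ⟨ha'0, ha'pos, haa', ha'le⟩ := weights_repaired (a := a) ha haw
  set a' : ℕ → ℝ := fun j => if j = 0 then (1 : ℝ) else a j with ha'def
  -- `u = G′∂_νᵀλ` and its equation
  set u := (gmlT (N0 ℓ Mh k P) ℓ k D.lev a * (dT (N0 ℓ Mh k P) ν)ᵀ) *ᵥ lam with hu
  have hLu : ∀ x, (perLapT (N0 ℓ Mh k P) *ᵥ u) x = ((dT (N0 ℓ Mh k P) ν)ᵀ *ᵥ lam) x - levC d ℓ a' (D.lev x.1)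
      * ∑ z ∈ Finset.univ.filter (fun z => blkOf D.toDomains z = blkOf D.toDomains x), u z := by
    intro x; rw [hu, ← Matrix.mulVec_mulVec]; exact perLapT_gmlT_apply D hMh1 hP ha'pos haa' _ x
  -- the local estimate
  obtain ⟨hI, hII, hIII, hIV⟩ := dGpd_local_estimate D hℓ hMh hR hP4 ha'0 μ ν y y' u lam hlam hLu
  rw [show dT (N0 ℓ Mh k P) μ * gmlT (N0 ℓ Mh k P) ℓ k D.lev a * (dT (N0 ℓ Mh k P) ν)ᵀ = dT (N0 ℓ Mh k P) μ * (gmlT (N0 ℓ Mh k P) ℓ k D.lev a * (dT (N0 ℓ Mh k P) ν)ᵀ)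
      from Matrix.mul_assoc _ _ _, ← Matrix.mulVec_mulVec]
  refine hI.trans ?_
  -- bookkeeping for the near blocks
  set 𝒩 := Finset.univ.filter (fun s => (bondT D).dist s y ≤ (d + 1) * (4 * (ℓ + 1) + 1) + 1) with h𝒩
  set Λ : ℝ := ∑ z, lam z ^ 2 with hΛ
  have hΛ0 : 0 ≤ Λ := Finset.sum_nonneg fun _ _ => sq_nonneg _
  set E : ℝ := Real.exp (δ * K) * Real.exp (-(δ * (geomT D).dist y y')) with hE
  have hE0 : 0 ≤ E := by positivity
  have hdd : 0 ≤ (geomT D).dist y y' := by show (0 : ℝ) ≤ (((bondT D).dist y y' : ℕ) : ℝ); positivity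
  have hmem : ∀ s ∈ 𝒩, (bondT D).dist s y ≤ K := fun s hs => (Finset.mem_filter.1 hs).2
  have hcard : ((𝒩.card : ℕ) : ℝ) ≤ CN :=
    card_near_le D (c := cq) (δ := δ) (α := 1 / 4) (by positivity) h261D y K
  have hwin : ∀ s ∈ 𝒩, ((ℓ : ℝ) + 1) ^ s.1.1 ≤ ((ℓ : ℝ) + 1) * ((ℓ : ℝ) + 1) ^ y.1.1 ∧ ((ℓ : ℝ) + 1) ^ y.1.1 ≤ ((ℓ : ℝ) + 1) * ((ℓ : ℝ) + 1) ^ s.1.1 := by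
    intro s hs
    obtain ⟨h1, h2⟩ := scale_window_of_distT_le D hMh1 hP hRK y s (hmem s hs)
    exact pow_window h1 h2
  -- p21's member 2 on the near blocks
  have hP2 : ∀ s ∈ 𝒩, ∑ x ∈ Finset.univ.filter (fun x => blkOf D.toDomains x = s), u x ^ 2 ≤ Cc * ((ℓ : ℝ) + 1) ^ s.1.1 * ((ℓ : ℝ) + 1) ^ y'.1.1 * E * Λ := by
    intro s hs
    have h := Hc k Mh R hMh hM hR hRNc P hP hP4 D a c haw hcw hrec ν s y' lam hlam
    refine h.trans ?_
    have hds : 0 ≤ (geomT D).dist s y' := by show (0 : ℝ) ≤ (((bondT D).dist s y' : ℕ) : ℝ); positivity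
    have := exp_near_le D hMh1 hP hδ.le y y' s (hmem s hs)
    have h0 : 0 ≤ Cc * ((ℓ : ℝ) + 1) ^ s.1.1 * ((ℓ : ℝ) + 1) ^ y'.1.1 := by positivity
    exact mul_le_mul_of_nonneg_right (mul_le_mul_of_nonneg_left this h0) hΛ0
  -- the (2.60) transfer `L^{j′} e^{−δd} ≤ L L^{j} e^{−δd/4}`
  have hX : 0 ≤ (R : ℝ) * (((ℓ : ℝ) + 1) * Mh) - 1 := by
    have : (1 : ℝ) ≤ (R : ℝ) * (((ℓ : ℝ) + 1) * Mh) := by exact_mod_cast hRM1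
    linarith
  have hthr1 : ((ℓ : ℝ) + 1) ^ |(1 : ℝ)| ≤ Real.exp (3 / 4 * δ * ((R : ℝ) * (((ℓ : ℝ) + 1) * Mh) - 1)) := by
    calc ((ℓ : ℝ) + 1) ^ |(1 : ℝ)| ≤ ((ℓ : ℝ) + 1) ^ (2 : ℝ) := Real.rpow_le_rpow_of_exponent_le hL1 (by norm_num)
      _ = ((ℓ : ℝ) + 1) ^ 2 := by norm_cast
      _ ≤ _ := hthr
      _ ≤ _ := Real.exp_le_exp.2 (by have := mul_nonneg hδ.le hX; linarith)
  set F : ℝ := Real.exp (-(δ / 4 * (geomT D).dist y y')) with hF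
  have hF0 : 0 ≤ F := (Real.exp_pos _).le
  have htr1 : ((ℓ : ℝ) + 1) ^ y'.1.1 * Real.exp (-(δ * (geomT D).dist y y')) ≤ ((ℓ : ℝ) + 1) * ((ℓ : ℝ) + 1) ^ y.1.1 * F := by
    have h := transfer_rpow D hMh1 hP hRM1 hδ.le (1 : ℝ) hthr1 y y'
    rw [show |(1 : ℝ)| = 1 by norm_num, Real.rpow_one, one_mul, one_mul, Real.rpow_natCast, Real.rpow_natCast] at h
    have hsplit : Real.exp (-(δ * (geomT D).dist y y'))
        = Real.exp (-(3 / 4 * δ * (geomT D).dist y y')) * Real.exp (-(δ / 4 * (geomT D).dist y y')) := by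
      rw [← Real.exp_add]; congr 1; ring
    rw [hsplit, ← mul_assoc, mul_comm (((ℓ : ℝ) + 1) ^ y'.1.1)]
    exact mul_le_mul_of_nonneg_right h (Real.exp_pos _).le
  have hLj : (0 : ℝ) < ((ℓ : ℝ) + 1) ^ y.1.1 := by positivity
  have hside : ((side D y : ℕ) : ℝ) = ((ℓ : ℝ) + 1) ^ y.1.1 := side_cast D y
  -- the two sums over `𝒩`
  have hU2 : ∑ s ∈ 𝒩, ∑ x ∈ Finset.univ.filter (fun x => blkOf D.toDomains x = s), u x ^ 2 ≤ CN * Cc * ((ℓ : ℝ) + 1) ^ 2 * (((ℓ : ℝ) + 1) ^ y.1.1) ^ 2 * (Real.exp (δ * K) * F * Λ) := by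
    have hterm : ∀ s ∈ 𝒩, ∑ x ∈ Finset.univ.filter (fun x => blkOf D.toDomains x = s), u x ^ 2 ≤ Cc * ((ℓ : ℝ) + 1) ^ 2 * (((ℓ : ℝ) + 1) ^ y.1.1) ^ 2 * (Real.exp (δ * K) * F * Λ) := by
      intro s hs
      obtain ⟨hw1, hw2⟩ := hwin s hs
      refine (hP2 s hs).trans ?_
      rw [hE]
      calc Cc * ((ℓ : ℝ) + 1) ^ s.1.1 * ((ℓ : ℝ) + 1) ^ y'.1.1 * (Real.exp (δ * K) * Real.exp (-(δ * (geomT D).dist y y'))) * Λ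
          = Cc * Real.exp (δ * K) * ((ℓ : ℝ) + 1) ^ s.1.1 * (((ℓ : ℝ) + 1) ^ y'.1.1 * Real.exp (-(δ * (geomT D).dist y y'))) * Λ := by ring
        _ ≤ Cc * Real.exp (δ * K) * (((ℓ : ℝ) + 1) * ((ℓ : ℝ) + 1) ^ y.1.1) * (((ℓ : ℝ) + 1) * ((ℓ : ℝ) + 1) ^ y.1.1 * F) * Λ :=
            mul_le_mul_of_nonneg_right (mul_le_mul (mul_le_mul_of_nonneg_left hw1 (by positivity)) htr1
              (by positivity) (by positivity)) hΛ0
        _ = _ := by ring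
    calc ∑ s ∈ 𝒩, ∑ x ∈ Finset.univ.filter (fun x => blkOf D.toDomains x = s), u x ^ 2 ≤ ∑ _s ∈ 𝒩, Cc * ((ℓ : ℝ) + 1) ^ 2 * (((ℓ : ℝ) + 1) ^ y.1.1) ^ 2 * (Real.exp (δ * K) * F * Λ) := Finset.sum_le_sum hterm
      _ = (𝒩.card : ℝ) * (Cc * ((ℓ : ℝ) + 1) ^ 2 * (((ℓ : ℝ) + 1) ^ y.1.1) ^ 2 * (Real.exp (δ * K) * F * Λ)) := by
          rw [Finset.sum_const, nsmul_eq_mul]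
      _ ≤ CN * (Cc * ((ℓ : ℝ) + 1) ^ 2 * (((ℓ : ℝ) + 1) ^ y.1.1) ^ 2 * (Real.exp (δ * K) * F * Λ)) :=
          mul_le_mul_of_nonneg_right hcard (by positivity)
      _ = _ := by ring
  have hWV : ∑ s ∈ 𝒩, a' s.1.1 * ((((ℓ : ℝ) + 1) ^ s.1.1) ^ 2)⁻¹ * ∑ x ∈ Finset.univ.filter (fun x => blkOf D.toDomains x = s), u x ^ 2 ≤ CN * (max aplus 0 * Cc * ((ℓ : ℝ) + 1) ^ 2) * (Real.exp (δ * K) * F * Λ) := by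
    have hterm : ∀ s ∈ 𝒩, a' s.1.1 * ((((ℓ : ℝ) + 1) ^ s.1.1) ^ 2)⁻¹ * ∑ x ∈ Finset.univ.filter (fun x => blkOf D.toDomains x = s), u x ^ 2
        ≤ max aplus 0 * Cc * ((ℓ : ℝ) + 1) ^ 2 * (Real.exp (δ * K) * F * Λ) := by
      intro s hs
      have hs1 : 1 ≤ s.1.1 := (scale_bounds D.toDomains s).1
      have hale : a' s.1.1 ≤ max aplus 0 := (ha'le s.1.1 hs1).trans (le_max_left _ _)
      have ha0 : 0 ≤ a' s.1.1 := ha'0 s.1.1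
      have hLs : (0 : ℝ) < ((ℓ : ℝ) + 1) ^ s.1.1 := by positivity
      obtain ⟨hw1, hw2⟩ := hwin s hs
      have hp2 := hP2 s hs
      -- `(L^{j_s})^{-2} · L^{j_s} L^{j'} E = L^{j'} E / L^{j_s} ≤ L² e^{δK} F`
      have hq : ((((ℓ : ℝ) + 1) ^ s.1.1) ^ 2)⁻¹ * (Cc * ((ℓ : ℝ) + 1) ^ s.1.1 * ((ℓ : ℝ) + 1) ^ y'.1.1 * E * Λ)
          ≤ Cc * ((ℓ : ℝ) + 1) ^ 2 * (Real.exp (δ * K) * F * Λ) := by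
        rw [hE]
        have e1 : ((((ℓ : ℝ) + 1) ^ s.1.1) ^ 2)⁻¹ * (Cc * ((ℓ : ℝ) + 1) ^ s.1.1 * ((ℓ : ℝ) + 1) ^ y'.1.1
            * (Real.exp (δ * K) * Real.exp (-(δ * (geomT D).dist y y'))) * Λ)
            = Cc * Real.exp (δ * K) * Λ * ((((ℓ : ℝ) + 1) ^ s.1.1)⁻¹ * (((ℓ : ℝ) + 1) ^ y'.1.1 * Real.exp (-(δ * (geomT D).dist y y')))) := by
          field_simp; try ring
        rw [e1]
        have hinv : (((ℓ : ℝ) + 1) ^ s.1.1)⁻¹ ≤ ((ℓ : ℝ) + 1) * (((ℓ : ℝ) + 1) ^ y.1.1)⁻¹ := by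
          rw [inv_le_comm₀ hLs (by positivity), mul_inv, inv_inv]
          calc (((ℓ : ℝ) + 1))⁻¹ * ((ℓ : ℝ) + 1) ^ y.1.1 ≤ (((ℓ : ℝ) + 1))⁻¹ * (((ℓ : ℝ) + 1) * ((ℓ : ℝ) + 1) ^ s.1.1) :=
                mul_le_mul_of_nonneg_left hw2 (by positivity)
            _ = ((ℓ : ℝ) + 1) ^ s.1.1 := by field_simp
        calc Cc * Real.exp (δ * K) * Λ * ((((ℓ : ℝ) + 1) ^ s.1.1)⁻¹ * (((ℓ : ℝ) + 1) ^ y'.1.1 * Real.exp (-(δ * (geomT D).dist y y'))))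
            ≤ Cc * Real.exp (δ * K) * Λ * ((((ℓ : ℝ) + 1) * (((ℓ : ℝ) + 1) ^ y.1.1)⁻¹) * (((ℓ : ℝ) + 1) * ((ℓ : ℝ) + 1) ^ y.1.1 * F)) :=
              mul_le_mul_of_nonneg_left (mul_le_mul hinv htr1 (by positivity) (by positivity)) (by positivity)
          _ = Cc * ((ℓ : ℝ) + 1) ^ 2 * (Real.exp (δ * K) * F * Λ) := by field_simp; try ring
      calc a' s.1.1 * ((((ℓ : ℝ) + 1) ^ s.1.1) ^ 2)⁻¹ * ∑ x ∈ Finset.univ.filter (fun x => blkOf D.toDomains x = s), u x ^ 2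
          = a' s.1.1 * (((((ℓ : ℝ) + 1) ^ s.1.1) ^ 2)⁻¹ * ∑ x ∈ Finset.univ.filter (fun x => blkOf D.toDomains x = s), u x ^ 2) := by ring
        _ ≤ max aplus 0 * (((((ℓ : ℝ) + 1) ^ s.1.1) ^ 2)⁻¹ * (Cc * ((ℓ : ℝ) + 1) ^ s.1.1 * ((ℓ : ℝ) + 1) ^ y'.1.1 * E * Λ)) :=
            mul_le_mul hale (mul_le_mul_of_nonneg_left hp2 (by positivity)) (by positivity) (le_max_right _ _)
        _ ≤ max aplus 0 * (Cc * ((ℓ : ℝ) + 1) ^ 2 * (Real.exp (δ * K) * F * Λ)) :=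
            mul_le_mul_of_nonneg_left hq (le_max_right _ _)
        _ = _ := by ring
    calc ∑ s ∈ 𝒩, a' s.1.1 * ((((ℓ : ℝ) + 1) ^ s.1.1) ^ 2)⁻¹ * ∑ x ∈ Finset.univ.filter (fun x => blkOf D.toDomains x = s), u x ^ 2 ≤ ∑ _s ∈ 𝒩, max aplus 0 * Cc * ((ℓ : ℝ) + 1) ^ 2 * (Real.exp (δ * K) * F * Λ) := Finset.sum_le_sum hterm
      _ = (𝒩.card : ℝ) * (max aplus 0 * Cc * ((ℓ : ℝ) + 1) ^ 2 * (Real.exp (δ * K) * F * Λ)) := by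
          rw [Finset.sum_const, nsmul_eq_mul]
      _ ≤ CN * (max aplus 0 * Cc * ((ℓ : ℝ) + 1) ^ 2 * (Real.exp (δ * K) * F * Λ)) :=
          mul_le_mul_of_nonneg_right hcard (by positivity)
      _ = _ := by ring
  -- `U²/L^{2j}`
  have hU2n : (∑ s ∈ 𝒩, ∑ x ∈ Finset.univ.filter (fun x => blkOf D.toDomains x = s), u x ^ 2) / ((side D y : ℝ) ^ 2) ≤ CN * Cc * ((ℓ : ℝ) + 1) ^ 2 * (Real.exp (δ * K) * F * Λ) := by
    rw [hside, div_le_iff₀ (by positivity)]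
    calc ∑ s ∈ 𝒩, ∑ x ∈ Finset.univ.filter (fun x => blkOf D.toDomains x = s), u x ^ 2 ≤ CN * Cc * ((ℓ : ℝ) + 1) ^ 2 * (((ℓ : ℝ) + 1) ^ y.1.1) ^ 2 * (Real.exp (δ * K) * F * Λ) := hU2
      _ = _ := by ring
  have hW'0 : 0 ≤ 2 * (∑ s ∈ 𝒩, a' s.1.1 * ((((ℓ : ℝ) + 1) ^ s.1.1) ^ 2)⁻¹ * ∑ x ∈ Finset.univ.filter (fun x => blkOf D.toDomains x = s), u x ^ 2) + 64 * ((d : ℝ) + 1) / ((side D y : ℝ) ^ 2) * (∑ s ∈ 𝒩, ∑ x ∈ Finset.univ.filter (fun x => blkOf D.toDomains x = s), u x ^ 2) := by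
    have : 0 ≤ ∑ s ∈ 𝒩, a' s.1.1 * ((((ℓ : ℝ) + 1) ^ s.1.1) ^ 2)⁻¹ * ∑ x ∈ Finset.univ.filter (fun x => blkOf D.toDomains x = s), u x ^ 2 := Finset.sum_nonneg fun s _ => mul_nonneg (mul_nonneg (ha'0 _) (by positivity))
      (Finset.sum_nonneg fun _ _ => sq_nonneg _)
    have h2 : 0 ≤ ∑ s ∈ 𝒩, ∑ x ∈ Finset.univ.filter (fun x => blkOf D.toDomains x = s), u x ^ 2 := Finset.sum_nonneg fun _ _ => Finset.sum_nonneg fun _ _ => sq_nonneg _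
    have h3 : (0 : ℝ) ≤ 64 * ((d : ℝ) + 1) / ((side D y : ℝ) ^ 2) := by positivity
    exact add_nonneg (mul_nonneg (by norm_num) this) (mul_nonneg h3 h2)
  have hB0 : 0 ≤ 32 / ((side D y : ℝ) ^ 2) * (∑ s ∈ 𝒩, ∑ x ∈ Finset.univ.filter (fun x => blkOf D.toDomains x = s), u x ^ 2) := by
    have h2 : 0 ≤ ∑ s ∈ 𝒩, ∑ x ∈ Finset.univ.filter (fun x => blkOf D.toDomains x = s), u x ^ 2 := Finset.sum_nonneg fun _ _ => Finset.sum_nonneg fun _ _ => sq_nonneg _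
    have h3 : (0 : ℝ) ≤ 32 / ((side D y : ℝ) ^ 2) := by positivity
    exact mul_nonneg h3 h2
  have hZ0 : 0 ≤ ∑ μ' : Fin (d + 1), ∑ x, cutoffT D y (tshift (N0 ℓ Mh k P) (unitVec μ') x) ^ 2 * (u (tshift (N0 ℓ Mh k P) (unitVec μ') x) - u x) ^ 2 := Finset.sum_nonneg fun _ _ => Finset.sum_nonneg fun _ _ => by positivity
  -- the bounds of `2W′ + B` and of `9Λ` near `y`
  have hWB : 2 * (2 * (∑ s ∈ 𝒩, a' s.1.1 * ((((ℓ : ℝ) + 1) ^ s.1.1) ^ 2)⁻¹ * ∑ x ∈ Finset.univ.filter (fun x => blkOf D.toDomains x = s), u x ^ 2) + 64 * ((d : ℝ) + 1) / ((side D y : ℝ) ^ 2) * (∑ s ∈ 𝒩, ∑ x ∈ Finset.univ.filter (fun x => blkOf D.toDomains x = s), u x ^ 2))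
        + 32 / ((side D y : ℝ) ^ 2) * (∑ s ∈ 𝒩, ∑ x ∈ Finset.univ.filter (fun x => blkOf D.toDomains x = s), u x ^ 2)
      ≤ CN * Cc * ((ℓ : ℝ) + 1) ^ 2 * (4 * max aplus 0 + 128 * ((d : ℝ) + 1) + 32) * (Real.exp (δ * K) * F * Λ) := by
    have e1 : 64 * ((d : ℝ) + 1) / ((side D y : ℝ) ^ 2) * (∑ s ∈ 𝒩, ∑ x ∈ Finset.univ.filter (fun x => blkOf D.toDomains x = s), u x ^ 2) = 64 * ((d : ℝ) + 1) * ((∑ s ∈ 𝒩, ∑ x ∈ Finset.univ.filter (fun x => blkOf D.toDomains x = s), u x ^ 2) / ((side D y : ℝ) ^ 2)) := by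
      ring
    have e2 : 32 / ((side D y : ℝ) ^ 2) * (∑ s ∈ 𝒩, ∑ x ∈ Finset.univ.filter (fun x => blkOf D.toDomains x = s), u x ^ 2) = 32 * ((∑ s ∈ 𝒩, ∑ x ∈ Finset.univ.filter (fun x => blkOf D.toDomains x = s), u x ^ 2) / ((side D y : ℝ) ^ 2)) := by ring
    rw [e1, e2]
    have hd0 : (0 : ℝ) ≤ 64 * ((d : ℝ) + 1) := by positivity
    have hprod := mul_le_mul_of_nonneg_left hU2n hd0
    linarith [hWV, hU2n, hprod]
  -- near / far
  by_cases hy' : (bondT D).dist y' y ≤ K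
  · have hnear : (1 : ℝ) ≤ Real.exp (δ * K) * F := by
      have := exp_near_le D hMh1 hP hδ.le y y' y' hy'
      rw [show (geomT D).dist y' y' = 0 by show (((bondT D).dist y' y' : ℕ) : ℝ) = 0; simp, mul_zero, neg_zero,
        Real.exp_zero] at this
      refine this.trans (mul_le_mul_of_nonneg_left (Real.exp_le_exp.2 ?_) (Real.exp_pos _).le)
      have := mul_nonneg hδ.le hdd; linarith
    have hq := quad_absorb hZ0 hW'0 hB0 hΛ0 hII hIII
    have h9 : 9 * Λ ≤ 9 * (Real.exp (δ * K) * F * Λ) := by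
      have := mul_le_mul_of_nonneg_right hnear hΛ0
      linarith
    calc ∑ μ' : Fin (d + 1), ∑ x, cutoffT D y (tshift (N0 ℓ Mh k P) (unitVec μ') x) ^ 2 * (u (tshift (N0 ℓ Mh k P) (unitVec μ') x) - u x) ^ 2 ≤ 2 * (2 * (∑ s ∈ 𝒩, a' s.1.1 * ((((ℓ : ℝ) + 1) ^ s.1.1) ^ 2)⁻¹ * ∑ x ∈ Finset.univ.filter (fun x => blkOf D.toDomains x = s), u x ^ 2) + 64 * ((d : ℝ) + 1) / ((side D y : ℝ) ^ 2) * (∑ s ∈ 𝒩, ∑ x ∈ Finset.univ.filter (fun x => blkOf D.toDomains x = s), u x ^ 2)) + 9 * Λ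
          + 32 / ((side D y : ℝ) ^ 2) * (∑ s ∈ 𝒩, ∑ x ∈ Finset.univ.filter (fun x => blkOf D.toDomains x = s), u x ^ 2) := hq
      _ ≤ CN * Cc * ((ℓ : ℝ) + 1) ^ 2 * (4 * max aplus 0 + 128 * ((d : ℝ) + 1) + 32) * (Real.exp (δ * K) * F * Λ)
          + 9 * (Real.exp (δ * K) * F * Λ) := by linarith
      _ = C * F * Λ := by rw [hCdef]; ring
  · rw [not_le] at hy'
    have hS0 := hIV hy'
    rw [hS0, abs_zero, mul_zero, zero_add] at hII
    calc ∑ μ' : Fin (d + 1), ∑ x, cutoffT D y (tshift (N0 ℓ Mh k P) (unitVec μ') x) ^ 2 * (u (tshift (N0 ℓ Mh k P) (unitVec μ') x) - u x) ^ 2 ≤ 2 * (∑ s ∈ 𝒩, a' s.1.1 * ((((ℓ : ℝ) + 1) ^ s.1.1) ^ 2)⁻¹ * ∑ x ∈ Finset.univ.filter (fun x => blkOf D.toDomains x = s), u x ^ 2) + 64 * ((d : ℝ) + 1) / ((side D y : ℝ) ^ 2) * (∑ s ∈ 𝒩, ∑ x ∈ Finset.univ.filter (fun x => blkOf D.toDomains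 x = s), u x ^ 2) := hII
      _ ≤ 2 * (2 * (∑ s ∈ 𝒩, a' s.1.1 * ((((ℓ : ℝ) + 1) ^ s.1.1) ^ 2)⁻¹ * ∑ x ∈ Finset.univ.filter (fun x => blkOf D.toDomains x = s), u x ^ 2) + 64 * ((d : ℝ) + 1) / ((side D y : ℝ) ^ 2) * (∑ s ∈ 𝒩, ∑ x ∈ Finset.univ.filter (fun x => blkOf D.toDomains x = s), u x ^ 2))
          + 32 / ((side D y : ℝ) ^ 2) * (∑ s ∈ 𝒩, ∑ x ∈ Finset.univ.filter (fun x => blkOf D.toDomains x = s), u x ^ 2) := by linarith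
      _ ≤ CN * Cc * ((ℓ : ℝ) + 1) ^ 2 * (4 * max aplus 0 + 128 * ((d : ℝ) + 1) + 32) * (Real.exp (δ * K) * F * Λ) := hWB
      _ ≤ CN * Cc * ((ℓ : ℝ) + 1) ^ 2 * (4 * max aplus 0 + 128 * ((d : ℝ) + 1) + 32) * (Real.exp (δ * K) * F * Λ)
          + 9 * (Real.exp (δ * K) * F * Λ) := by
          have : 0 ≤ 9 * (Real.exp (δ * K) * F * Λ) := by positivity
          linarith
      _ = C * F * Λ := by rw [hCdef]; ring

end MemberDGD

end Literature.MathematicalPhysics.QuantumFieldTheory.Balaban1983to89.B9Ineq346SecondOrderCaccioppoliTorus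

end
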